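import Summits.KontsevichZagierPeriods.KontsevichZagierPeriods.Theorems.SoloBlindOctaPrep
import HarnessLib

/-!
# The octahedral involution at level 24 (solo-blind)

The companion of the tetrahedral chain (`SoloBlindTetra`, level `12`) one polyhedron up.  Along
`t = v⁴` the four Beta forms `B(a_j, 1/6)`, `a_j = (6j+1)/24` (`j = 0,…,3`), become
`4 v^j E(v) dv` on `(0,1)` with `E = (v(1-v⁴))^{-5/6}`: one local system on `P¹` whose six
singular points `0, ±1, ±i, ∞` are the vertices of the octahedron, all with the same local
monodromy — so the *whole* octahedral group `S₄ ⊃ ℤ/4` acts on the fibre, not just the cyclic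
group of the pull-back.  The rotation `ρ(v) = (1-v)/(1+v)` maps `(0,1)` onto itself and pulls
`E dv` back to `c (1+v)³ E dv`, `c = 2·8^{-5/6} = √2/4` (`SoloBlindOctaPrep.oct_pull`).
Expanding `(1+v)³` gives, inside the Kontsevich–Zagier rules (moves: two substitutions and three
integrand-additivity splits, all on `(0,1)`),

  `β(1/24,1/6) = c • (β(1/24,1/6) + 3β(7/24,1/6) + 3β(13/24,1/6) + β(19/24,1/6))`

(`betaQ_octa`), and with the two `S₃`-orbit relations `sin(19π/24) β(19/24,1/6) =
sin(π/24) β(1/24,1/6)`, `sin(13π/24) β(13/24,1/6) = sin(7π/24) β(7/24,1/6)`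
(`betaQ_orbit`) the proportionality

  `β(7/24,1/6) ≐ β(1/24,1/6)`   (`betaQ_propTo_octa`),

numerically `B(7/24,1/6)/B(1/24,1/6) = (1 - ℓ)/(2√2 - 1 + m) = 0.29885849…`,
`ℓ = sin(π/24)/sin(19π/24)`, `m = sin(7π/24)/sin(13π/24)`.  This merges the level-24 orbits
`{1,4,19}` and `{4,7,13}`, which the multiplication-formula moves (reflection, `S₃`, Gauss
multiplication read inside the rules) leave isolated from each other.

Classification remark (recorded in the solo notes): among pull-backs `t = v^k` of Beta forms the
only accidents where a finite Möbius group strictly larger than the visible cyclic/dihedral one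
preserves the pulled-back local system are the tetrahedral one at level `12` (`A₄ ⊃ ℤ/3`) and
this octahedral one at level `24` (`S₄ ⊃ ℤ/4`); the icosahedral group gives nothing.
-/

noncomputable section

open Set MeasureTheory MvPolynomial

namespace Summit.KontsevichZagierPeriods.KontsevichZagierPeriods.Theorems

namespace SoloBlind

open Literature.ModelTheory.ExponentialFields (IsSemialgebraic)
open Literature.NumberTheory.Transcendental
open Literature.NumberTheory.Transcendental.KZ

/-! ## The representations (all on the line `(0,1)`) -/

/-- `R_j = [(0,1), 4 v^j E(v)]`. -/
def octR (j : ℕ) : IntegralRep 1 :=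
  lineRep (Ioo 0 1) (fun v => 4 * (v ^ j * octE v)) mix_line_sa (sa_octR j) (integrableOn_octR j)

/-- `S = [(0,1), c · 4(1+v)³ E(v)]`, the pull-back of `R₀` along `ρ`. -/
def octS : IntegralRep 1 :=
  lineRep (Ioo 0 1) (fun v => octC * (4 * ((1 + v) ^ 3 * octE v))) mix_line_sa sa_octS
    integrableOn_octS

/-- `T₁₂₃ = [(0,1), 3c·4vE + (3c·4v²E + c·4v³E)]`. -/
def octT123 : IntegralRep 1 :=
  lineRep (Ioo 0 1) (fun v => 3 * octC * (4 * (v ^ 1 * octE v)) +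
    (3 * octC * (4 * (v ^ 2 * octE v)) + octC * (4 * (v ^ 3 * octE v)))) mix_line_sa sa_octT123
    integrableOn_octT123

/-- `T₂₃ = [(0,1), 3c·4v²E + c·4v³E]`. -/
def octT23 : IntegralRep 1 :=
  lineRep (Ioo 0 1) (fun v => 3 * octC * (4 * (v ^ 2 * octE v)) + octC * (4 * (v ^ 3 * octE v)))
    mix_line_sa sa_octT23 integrableOn_octT23

/-- `3c` is algebraic. -/
theorem isAlgebraic_three_octC : IsAlgebraic ℚ (3 * octC) :=
  IsAlgebraic.mul (by simpa using isAlgebraic_rat ℚ (A := ℝ) 3) isAlgebraic_octC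

/-- `3c` as an element of `K₀`. -/
def octCK3 : K₀ := ⟨3 * octC, mem_K₀_iff.mpr isAlgebraic_three_octC⟩

/-- `(3c : ℝ) = 3c`. -/
@[simp] theorem coe_octCK3 : ((octCK3 : K₀) : ℝ) = 3 * octC := rfl

/-! ## The moves -/

/-- **Move 1:** `R_j ≡ β(a_j, 1/6)` (substitution `t = v⁴`). -/
theorem octR_sub_betaRep (j : ℕ) :
    of (octR j) - of (betaRep (octA j) (1 / 6) (octA_pos j) (by norm_num)) ∈ relations := by
  unfold octR betaRep
  exact lineRep_subst (fun v => v ^ 4) (fun v => 4 * v ^ 3) isSemialgebraicFunOn_pow_four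
    (fun v _ => hasDerivWithinAt_pow_four _ v) injOn_pow_four image_pow_four
    (fun v hv => oct_quart hv j)

/-- **Move 2:** `S ≡ R₀` (the octahedral substitution `v ↦ ρ(v) = (1-v)/(1+v)`). -/
theorem octS_sub_octR : of octS - of (octR 0) ∈ relations := by
  unfold octS octR
  exact lineRep_subst octRho octRho' sa_octRho
    (fun v hv => (hasDerivAt_octRho (show (1:ℝ) + v ≠ 0 by linarith [hv.1])).hasDerivWithinAt)
    injOn_octRho image_octRho (fun v hv => oct_pull hv)

/-- **Move 3:** `S ≡ c·R₀ + T₁₂₃` (integrand additivity). -/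
theorem octS_sub_sub :
    of octS - of ((octR 0).constMul octC isAlgebraic_octC) - of octT123 ∈ relations :=
  of_sub_sub_mem_relations_of_add rfl rfl fun x _ => by
    simp only [octS, octR, octT123, lineRep_integrand, IntegralRep.integrand_constMul]
    ring

/-- **Move 4:** `T₁₂₃ ≡ 3c·R₁ + T₂₃`. -/
theorem octT123_sub_sub :
    of octT123 - of ((octR 1).constMul (3 * octC) isAlgebraic_three_octC) - of octT23 ∈
      relations :=
  of_sub_sub_mem_relations_of_add rfl rfl fun x _ => by
    simp only [octR, octT123, octT23, lineRep_integrand, IntegralRep.integrand_constMul]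

/-- **Move 5:** `T₂₃ ≡ 3c·R₂ + c·R₃`. -/
theorem octT23_sub_sub :
    of octT23 - of ((octR 2).constMul (3 * octC) isAlgebraic_three_octC) -
      of ((octR 3).constMul octC isAlgebraic_octC) ∈ relations :=
  of_sub_sub_mem_relations_of_add rfl rfl fun x _ => by
    simp only [octR, octT23, lineRep_integrand, IntegralRep.integrand_constMul]

/-! ## In `Q` -/

/-- `[R_j] = β(a_j, 1/6)`. -/
theorem octR_eq (j : ℕ) : mkQ (of (octR j)) = betaQ (octA j) (1 / 6) := by
  rw [betaQ_eq (octA_pos j) (by norm_num)]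
  exact mkQ_eq_mkQ_iff.mpr (octR_sub_betaRep j)

/-- `[c·R_j] = c • β(a_j, 1/6)`. -/
theorem octR_constMul_eq (j : ℕ) :
    mkQ (of ((octR j).constMul octC isAlgebraic_octC)) = octCK • betaQ (octA j) (1 / 6) := by
  rw [mkQ_constMul, octR_eq]
  exact congrArg (· • betaQ (octA j) (1 / 6)) (Subtype.ext (by simp))

/-- `[3c·R_j] = 3c • β(a_j, 1/6)`. -/
theorem octR_constMul_three_eq (j : ℕ) :
    mkQ (of ((octR j).constMul (3 * octC) isAlgebraic_three_octC)) =
      octCK3 • betaQ (octA j) (1 / 6) := by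
  rw [mkQ_constMul, octR_eq]
  rfl

/-- **The octahedral relation** inside the Kontsevich–Zagier rules:
`β(1/24,1/6) = c • β(1/24,1/6) + 3c • β(7/24,1/6) + 3c • β(13/24,1/6) + c • β(19/24,1/6)`,
`c = √2/4`. -/
theorem betaQ_octa : betaQ (1 / 24) (1 / 6) = octCK • betaQ (1 / 24) (1 / 6) +
    (octCK3 • betaQ (7 / 24) (1 / 6) + (octCK3 • betaQ (13 / 24) (1 / 6) +
      octCK • betaQ (19 / 24) (1 / 6))) := by
  have a0 : octA 0 = 1 / 24 := by unfold octA; norm_num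
  have a1 : octA 1 = 7 / 24 := by unfold octA; norm_num
  have a2 : octA 2 = 13 / 24 := by unfold octA; norm_num
  have a3 : octA 3 = 19 / 24 := by unfold octA; norm_num
  have h1 : betaQ (1 / 24) (1 / 6) = mkQ (of octS) := by
    rw [← a0, ← octR_eq]
    exact (mkQ_eq_mkQ_iff.mpr octS_sub_octR).symm
  have h2 : mkQ (of octS) = mkQ (of ((octR 0).constMul octC isAlgebraic_octC)) +
      mkQ (of octT123) := by
    rw [← map_add, mkQ_eq_mkQ_iff]
    have h := octS_sub_sub
    rwa [sub_sub] at h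
  have h3 : mkQ (of octT123) = mkQ (of ((octR 1).constMul (3 * octC) isAlgebraic_three_octC)) +
      mkQ (of octT23) := by
    rw [← map_add, mkQ_eq_mkQ_iff]
    have h := octT123_sub_sub
    rwa [sub_sub] at h
  have h4 : mkQ (of octT23) = mkQ (of ((octR 2).constMul (3 * octC) isAlgebraic_three_octC)) +
      mkQ (of ((octR 3).constMul octC isAlgebraic_octC)) := by
    rw [← map_add, mkQ_eq_mkQ_iff]
    have h := octT23_sub_sub
    rwa [sub_sub] at h
  rw [h2, h3, h4, octR_constMul_eq, octR_constMul_three_eq, octR_constMul_three_eq,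
    octR_constMul_eq, a0, a1, a2, a3] at h1
  exact h1

/-! ## The proportionality `β(7/24,1/6) ≐ β(1/24,1/6)` -/

/-- `sin(π/24) < sin(19π/24)`. -/
theorem sin_one_lt_sin_nineteen :
    Real.sin (Real.pi * (1 / 24)) < Real.sin (Real.pi * (19 / 24)) := by
  have h : Real.sin (Real.pi * (19 / 24)) = Real.sin (Real.pi * (5 / 24)) := by
    rw [← Real.sin_pi_sub]
    ring_nf
  rw [h]
  have hpi := Real.pi_pos
  exact Real.sin_lt_sin_of_lt_of_le_pi_div_two (by linarith) (by linarith) (by linarith)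

/-- The coefficient `s₁₃((1-c)s₁₉ - c s₁)` of `β(1/24,1/6)` is nonzero (`c < 1/2`, `s₁ < s₁₉`). -/
theorem octCoeff_ne_zero :
    sinQ (13 / 24) * ((1 - octCK) * sinQ (19 / 24) - octCK * sinQ (1 / 24)) ≠ 0 := by
  refine mul_ne_zero (sinQ_ne_zero (by norm_num) (by norm_num)) ?_
  intro h
  have h' := congrArg (fun z : K₀ => (z : ℝ)) h
  simp only [AddSubgroupClass.coe_sub, MulMemClass.coe_mul, OneMemClass.coe_one, coe_octCK,
    sinQ_val, ZeroMemClass.coe_zero] at h'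
  push_cast at h'
  have hpi := Real.pi_pos
  have h1 : 0 < Real.sin (Real.pi * (1 / 24)) :=
    Real.sin_pos_of_pos_of_lt_pi (by positivity) (by linarith)
  have h19 := sin_one_lt_sin_nineteen
  have hc := octC_lt_half
  have hc0 := octC_pos
  nlinarith

/-- The coefficient `3c s₁₉(s₁₃ + s₇)` of `β(7/24,1/6)` is nonzero. -/
theorem octCoeff'_ne_zero : octCK3 * sinQ (19 / 24) * (sinQ (13 / 24) + sinQ (7 / 24)) ≠ 0 := by
  have hc : (octCK3 : K₀) ≠ 0 := by
    intro h
    have h' := congrArg (fun z : K₀ => (z : ℝ)) h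
    simp only [coe_octCK3, ZeroMemClass.coe_zero] at h'
    linarith [octC_pos]
  exact mul_ne_zero (mul_ne_zero hc (sinQ_ne_zero (by norm_num) (by norm_num)))
    (sinQ_add_sinQ_ne_zero (by norm_num) (by norm_num) (by norm_num) (by norm_num))

/-- **`β(7/24,1/6) ≐ β(1/24,1/6)`** inside the Kontsevich–Zagier rules: the octahedral
involution merges the level-24 orbits `{1,4,19}` and `{4,7,13}`.  Precisely
`3c s₁₉(s₁₃+s₇) • β(7/24,1/6) = s₁₃((1-c)s₁₉ - c s₁) • β(1/24,1/6)` (`s_k = sin(kπ/24)`). -/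
theorem betaQ_propTo_octa : PropTo (betaQ (7 / 24) (1 / 6)) (betaQ (1 / 24) (1 / 6)) := by
  have hsum := betaQ_octa
  have h3 := (betaQ_orbit (19 / 24) (1 / 24) (1 / 6) (by norm_num) (by norm_num) (by norm_num)
    (by norm_num)).1
  have h2 := (betaQ_orbit (13 / 24) (7 / 24) (1 / 6) (by norm_num) (by norm_num) (by norm_num)
    (by norm_num)).1
  refine PropTo.of_smul_eq_smul octCoeff'_ne_zero octCoeff_ne_zero ?_
  have key : (sinQ (19 / 24) * sinQ (13 / 24)) • betaQ (1 / 24) (1 / 6) =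
      (sinQ (19 / 24) * sinQ (13 / 24) * octCK) • betaQ (1 / 24) (1 / 6) +
      (octCK3 * sinQ (19 / 24) * sinQ (13 / 24)) • betaQ (7 / 24) (1 / 6) +
      (octCK3 * sinQ (19 / 24)) • (sinQ (13 / 24) • betaQ (13 / 24) (1 / 6)) +
      (octCK * sinQ (13 / 24)) • (sinQ (19 / 24) • betaQ (19 / 24) (1 / 6)) := by
    conv_lhs => rw [hsum]
    module
  rw [h2, h3] at key
  linear_combination (norm := module) -key
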